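import Summits.CriticalPhenomena.CardyFormulaZ2.Theorems.CardyAnchoredRigiditySubseqCardySelfDualNotBoth
import Summits.CriticalPhenomena.CardyFormulaZ2.Theorems.CardyAnchoredRigiditySubseqCardySelfDualDualChain
import Summits.CriticalPhenomena.CardyFormulaZ2.Theorems.CardyAnchoredRigiditySubseqCardySelfDualChartBridge
import Summits.CriticalPhenomena.CardyFormulaZ2.Theorems.CardyAnchoredRigiditySubseqCardySelfDualNearCharts
import Literature.Probability.Percolation.QuadCrossingSquareModel
import Literature.Probability.Percolation.QuadCrossingMeasurability
import Literature.Probability.Percolation.QuadCrossingRotationInvarianceProofs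
import Literature.Probability.Percolation.BoxCrossingUpperBound

/-!
# Self-duality of joint sequential limits, mesh level: the two one-sided duality bounds
# (crux `SubseqCardy`, stmt-CriticalPhenomena-5768, line `registered`: structure of joint limits, part 8b)

Route `CardyAnchoredRigidity` (decl shared with `CardyLocalRigidity`), sub-problem `CardyFormulaZ2`, lead c4.
Part 8 of the structure theory proves GENERAL SELF-DUALITY of every joint sequential limit `g` of the
bond-`ℤ²` crossing probabilities: `g R + g R⁺ = 1` for every conformal rectangle `R` and its cyclic
re-marking `R⁺` (arcs shifted by one). This file is the MESH-LEVEL statement behind it, for the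
Schramm–Smirnov quad-crossing probabilities `quadCrossingProb δ`: given a square model `Φ` of `R`
(`IsSquareModel R Φ`: `Φ` maps `(-1,1)²` onto `R`, side `k` onto `R.arc k`) and a margin `ν ∈ (0, 1/2)`,
for all meshes `δ` below a threshold `δ₀(Φ, ν)`,

* `1 ≤ P[𝒞_δ(R)] + P[𝒞_δ(L_ν)]` (`one_le_add`), `L_ν = Φ(swap([-1-2ν, 1+2ν] × [-1+2ν, 1-2ν]))` the
  EASIER transversal quad (crossed between `Φ`'s right and left sides pulled in by `2ν`, over a height
  enlarged by `2ν`): if `R` has no open crossing then the dual configuration has a chart crossing of the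
  `ν`-perturbed transversal rectangle (`selfDual_chart_atLeastOne`, part B: dual path + dual face chain),
  i.e. a quad crossing for the dual lattice `δℤ² + δ(½,½)` (`chartCrossed_iff_mem_quadCrossing_perturbQuad`,
  part C), which contains a crossing of the fixed quad `L_ν` read on `δℤ²`
  (`quadCrossing_perturbQuad_mono_of_near`, part D, the charts `Φ` and `Φ - δ(½,½)` being `ν`-close),
  and `P_{1/2}` is self-dual (`bondPercolation_half_real_preimage_dualConfig`);
* `P[𝒞_δ(R)] + P[𝒞_δ(U_ν)] ≤ 1` (`add_le_one`), `U_ν = Φ(swap([-1+2ν, 1-2ν] × [-1-2ν, 1+2ν]))` the HARDER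
  transversal quad: an open crossing of `R` and a dual-open crossing of the `ν`-harder transversal
  rectangle (shifted) cannot coexist (`selfDual_chart_notBoth`, part A: plus position), the latter event
  contains the shifted-back crossing event of `U_ν` (part D again), and quad-crossing events are
  measurable, so their `dualConfig`-preimages have the same probability.

The threshold is the `4δ`-modulus of continuity of `Φ⁻¹` (`exists_mesh_threshold`). Registered sub-goal:
`selfDual_mesh_bounds`. Part 8c (`…SubseqCardySelfDual.lean`) passes to the limit along the mesh sequence.

References: O. Schramm, S. Smirnov, Ann. Probab. 39 (2011) §1.3 (duality of quad crossings), proof of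
Lemma 6.1; G. Grimmett, *Percolation* (1999) §11.2 (planar duality, self-duality of `P_{1/2}`);
B. Bollobás, O. Riordan, *Percolation* (2006) Ch. 5 Lemma 1.
-/

noncomputable section

namespace Summit.CriticalPhenomena.CardyFormulaZ2.Cruxes.SubseqCardy.Birth

open Set Filter Topology Metric MeasureTheory
open Literature.Probability.RandomPlanarGeometry (ConformalRectangle)
open Literature.Probability.LatticeModels
open Literature.Probability.Percolation (BondConfig bondPercolation half dualConfig openEdgeUnion quadCrossing
  quadCrossingProb perturbQuad IsSquareModel measurableSet_quadCrossing measurable_dualConfig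
  bondPercolation_half_real_preimage_dualConfig closure_perturbQuad_carrier)
open Literature.Probability.Percolation.SSContinuity (ChartCrossed swapC dualShift swapC_swapC norm_dualShift_le
  exists_forall_dist_symm_le_of_homeomorph abs_re_im_le_dist)

namespace SelfDual

/-! ### The chart of a square model, swapped and shifted -/

/-- `swap ∘ swap ∘ Φ = Φ`. [folklore] -/
theorem swapC_trans_swapC_trans (Φ : ℂ ≃ₜ ℂ) : swapC.trans (swapC.trans Φ) = Φ := by
  ext z
  show Φ (swapC (swapC z)) = Φ z
  rw [swapC_swapC]

variable {R : ConformalRectangle} {Φ : ℂ ≃ₜ ℂ}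

/-- **The crossing event of `R` is the chart crossing of the model square in the swapped chart**:
`ω ∈ 𝒞_δ(R) ↔ ChartCrossed (swap ∘ Φ) (-1) 1 (-1) 1 δ ω` (bridge of part C at the square, plus
`IsSquareModel.quadCrossing_perturbQuad_eq`). [folklore] -/
theorem mem_quadCrossing_iff_chartCrossed (hΦ : IsSquareModel R Φ) {δ : ℝ} (hδ : 0 < δ)
    (ω : BondConfig (Site 2)) :
    ω ∈ quadCrossing R δ ↔ ChartCrossed (swapC.trans Φ) (-1) 1 (-1) 1 δ ω := by
  have key := chartCrossed_iff_mem_quadCrossing_perturbQuad (swapC.trans Φ) (-1) 1 (-1) 1 (by norm_num)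
    (by norm_num) δ hδ ω
  rw [swapC_trans_swapC_trans, hΦ.quadCrossing_perturbQuad_eq δ] at key
  exact key.symm

/-- Points of a square-model box with coordinates bounded by `2` are drawn into `Φ(B̄(0, 5))`. [folklore] -/
theorem apply_swapC_mem_image_closedBall (Φ : ℂ ≃ₜ ℂ) {w : ℂ} (hre : |w.re| ≤ 2) (him : |w.im| ≤ 2) :
    Φ (swapC w) ∈ Φ '' closedBall (0 : ℂ) 5 := by
  refine ⟨swapC w, ?_, rfl⟩
  rw [mem_closedBall, dist_zero_right]
  calc ‖swapC w‖ ≤ |(swapC w).re| + |(swapC w).im| := Complex.norm_le_abs_re_add_abs_im _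
    _ ≤ 2 + 2 := by
        rw [Literature.Probability.Percolation.SSContinuity.swapC_re,
          Literature.Probability.Percolation.SSContinuity.swapC_im]
        exact add_le_add him hre
    _ ≤ 5 := by norm_num

/-- Points of the closed quad `(swap ∘ G)(box)` come from box points. [folklore] -/
theorem exists_eq_of_mem_closure_perturbQuad (G : ℂ ≃ₜ ℂ) {x₀ x₁ y₀ y₁ : ℝ} (hx : x₀ < x₁) (hy : y₀ < y₁)
    {z : ℂ} (hz : z ∈ closure (perturbQuad (swapC.trans G) x₀ x₁ y₀ y₁ hx hy).carrier) :
    ∃ w : ℂ, w.re ∈ Icc x₀ x₁ ∧ w.im ∈ Icc y₀ y₁ ∧ z = G (swapC w) := by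
  rw [closure_perturbQuad_carrier] at hz
  obtain ⟨w, hw, rfl⟩ := hz
  exact ⟨w, (Complex.mem_reProdIm.1 hw).1, (Complex.mem_reProdIm.1 hw).2, rfl⟩

/-- **The `4δ`-modulus of `Φ⁻¹` as a mesh threshold**: for every `ν > 0` there is `δ₀ > 0` such that for
`0 < δ ≤ δ₀`, plane points within `4δ` of a point of `Φ(B̄(0,5))` have `Φ⁻¹`-images within `ν`. [folklore] -/
theorem exists_mesh_threshold (Φ : ℂ ≃ₜ ℂ) {ν : ℝ} (hν : 0 < ν) :
    ∃ δ₀ : ℝ, 0 < δ₀ ∧ ∀ δ : ℝ, 0 < δ → δ ≤ δ₀ → ∀ p q : ℂ, q ∈ Φ '' closedBall (0 : ℂ) 5 →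
      dist p q ≤ 4 * δ → dist (Φ.symm p) (Φ.symm q) ≤ ν := by
  obtain ⟨m, hm, hmod⟩ := exists_forall_dist_symm_le_of_homeomorph Φ hν
  refine ⟨min m 1 / 4, by positivity, fun δ _ hδ₀ p q hq hpq => ?_⟩
  have h4 : 4 * δ ≤ min m 1 := by linarith
  have hq' : q ∈ cthickening 1 (Φ '' closedBall (0 : ℂ) 5) := self_subset_cthickening _ hq
  have hp' : p ∈ cthickening 1 (Φ '' closedBall (0 : ℂ) 5) :=
    mem_cthickening_of_dist_le p q 1 _ hq (hpq.trans (h4.trans (min_le_right _ _)))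
  exact hmod p q hp' hq' (hpq.trans (h4.trans (min_le_left _ _)))

section Near

variable {δ ν : ℝ} (hδ : 0 < δ)
  (hmod : ∀ p q : ℂ, q ∈ Φ '' closedBall (0 : ℂ) 5 → dist p q ≤ 4 * δ → dist (Φ.symm p) (Φ.symm q) ≤ ν)
include hδ hmod

/-- The charts `swap ∘ Φ` (fixed) and `swap ∘ (Φ - δ(½,½))` (moving with the mesh) are `ν`-close, in the
sense of part D, on the closed quad of a box of the FIXED chart with coordinates bounded by `2`.
[folklore] -/
theorem near_of_fixed {x₀ x₁ y₀ y₁ : ℝ} (hx : x₀ < x₁) (hy : y₀ < y₁) (h₀ : -2 ≤ x₀) (h₁ : x₁ ≤ 2)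
    (h₂ : -2 ≤ y₀) (h₃ : y₁ ≤ 2) :
    ∀ z ∈ closure (perturbQuad (swapC.trans Φ) x₀ x₁ y₀ y₁ hx hy).carrier,
      |((swapC.trans (Φ.trans (Homeomorph.addRight (-dualShift δ)))).symm z).re -
          ((swapC.trans Φ).symm z).re| ≤ ν ∧
        |((swapC.trans (Φ.trans (Homeomorph.addRight (-dualShift δ)))).symm z).im -
          ((swapC.trans Φ).symm z).im| ≤ ν := by
  intro z hz
  obtain ⟨w, hwre, hwim, rfl⟩ := exists_eq_of_mem_closure_perturbQuad Φ hx hy hz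
  have hre : |w.re| ≤ 2 := abs_le.2 ⟨by linarith [hwre.1], by linarith [hwre.2]⟩
  have him : |w.im| ≤ 2 := abs_le.2 ⟨by linarith [hwim.1], by linarith [hwim.2]⟩
  have hmem := apply_swapC_mem_image_closedBall Φ hre him
  have hd : dist (Φ (swapC w) + - -dualShift δ) (Φ (swapC w)) ≤ 4 * δ := by
    rw [dist_eq_norm, neg_neg, add_sub_cancel_left]
    linarith [norm_dualShift_le hδ.le]
  have h := hmod _ _ hmem hd
  have h' := abs_re_im_le_dist (Φ.symm (Φ (swapC w) + - -dualShift δ)) (Φ.symm (Φ (swapC w)))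
  show |(swapC (Φ.symm (Φ (swapC w) + - -dualShift δ))).re - (swapC (Φ.symm (Φ (swapC w)))).re| ≤ ν ∧
    |(swapC (Φ.symm (Φ (swapC w) + - -dualShift δ))).im - (swapC (Φ.symm (Φ (swapC w)))).im| ≤ ν
  simp only [Literature.Probability.Percolation.SSContinuity.swapC_re,
    Literature.Probability.Percolation.SSContinuity.swapC_im]
  exact ⟨h'.2.trans h, h'.1.trans h⟩

/-- The charts `swap ∘ (Φ - δ(½,½))` (moving) and `swap ∘ Φ` (fixed) are `ν`-close, in the sense of part
D, on the closed quad of a box of the MOVING chart with coordinates bounded by `2`. [folklore] -/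
theorem near_of_moving {x₀ x₁ y₀ y₁ : ℝ} (hx : x₀ < x₁) (hy : y₀ < y₁) (h₀ : -2 ≤ x₀) (h₁ : x₁ ≤ 2)
    (h₂ : -2 ≤ y₀) (h₃ : y₁ ≤ 2) :
    ∀ z ∈ closure (perturbQuad (swapC.trans (Φ.trans (Homeomorph.addRight (-dualShift δ)))) x₀ x₁ y₀ y₁ hx hy).carrier,
      |((swapC.trans Φ).symm z).re -
          ((swapC.trans (Φ.trans (Homeomorph.addRight (-dualShift δ)))).symm z).re| ≤ ν ∧
        |((swapC.trans Φ).symm z).im -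
          ((swapC.trans (Φ.trans (Homeomorph.addRight (-dualShift δ)))).symm z).im| ≤ ν := by
  intro z hz
  obtain ⟨w, hwre, hwim, rfl⟩ :=
    exists_eq_of_mem_closure_perturbQuad (Φ.trans (Homeomorph.addRight (-dualShift δ))) hx hy hz
  have hre : |w.re| ≤ 2 := abs_le.2 ⟨by linarith [hwre.1], by linarith [hwre.2]⟩
  have him : |w.im| ≤ 2 := abs_le.2 ⟨by linarith [hwim.1], by linarith [hwim.2]⟩
  have hmem := apply_swapC_mem_image_closedBall Φ hre him
  -- the moving chart point and its shift back
  have e1 : (Φ.trans (Homeomorph.addRight (-dualShift δ))) (swapC w) = Φ (swapC w) + -dualShift δ := rfl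
  have e2 : Φ (swapC w) + -dualShift δ + - -dualShift δ = Φ (swapC w) := by
    rw [neg_neg, neg_add_cancel_right]
  have hd : dist (Φ (swapC w) + -dualShift δ) (Φ (swapC w)) ≤ 4 * δ := by
    rw [dist_eq_norm, add_sub_cancel_left, norm_neg]
    linarith [norm_dualShift_le hδ.le]
  have h := hmod _ _ hmem hd
  have h' := abs_re_im_le_dist (Φ.symm (Φ (swapC w) + -dualShift δ)) (Φ.symm (Φ (swapC w)))
  show |(swapC (Φ.symm ((Φ.trans (Homeomorph.addRight (-dualShift δ))) (swapC w)))).re -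
      (swapC (Φ.symm ((Φ.trans (Homeomorph.addRight (-dualShift δ))) (swapC w) + - -dualShift δ))).re| ≤ ν ∧
    |(swapC (Φ.symm ((Φ.trans (Homeomorph.addRight (-dualShift δ))) (swapC w)))).im -
      (swapC (Φ.symm ((Φ.trans (Homeomorph.addRight (-dualShift δ))) (swapC w) + - -dualShift δ))).im| ≤ ν
  rw [e1, e2]
  simp only [Literature.Probability.Percolation.SSContinuity.swapC_re,
    Literature.Probability.Percolation.SSContinuity.swapC_im]
  exact ⟨h'.2.trans h, h'.1.trans h⟩

end Near

/-! ### The lower bound: no open crossing of `R` forces a crossing of `L_ν` read on the dual lattice -/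

/-- **`1 ≤ P[𝒞_δ(R)] + P[𝒞_δ(L_ν)]`** below the mesh threshold (`L_ν` the easier transversal quad).
[cite: SchrammSmirnov2011, proof of Lemma 6.1] -/
theorem one_le_add (hΦ : IsSquareModel R Φ) {ν δ : ℝ} (hν : 0 < ν) (hν2 : ν < 1 / 2) (hδ : 0 < δ)
    (hmod : ∀ p q : ℂ, q ∈ Φ '' closedBall (0 : ℂ) 5 → dist p q ≤ 4 * δ → dist (Φ.symm p) (Φ.symm q) ≤ ν)
    (hx : (-1 - 2 * ν : ℝ) < 1 + 2 * ν) (hy : (-1 + 2 * ν : ℝ) < 1 - 2 * ν) :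
    1 ≤ quadCrossingProb δ R +
      quadCrossingProb δ (perturbQuad (swapC.trans Φ) (-1 - 2 * ν) (1 + 2 * ν) (-1 + 2 * ν) (1 - 2 * ν) hx hy) := by
  set Φ' : ℂ ≃ₜ ℂ := Φ.trans (Homeomorph.addRight (-dualShift δ)) with hΦ'
  set L : Set (BondConfig (Site 2)) :=
    quadCrossing (perturbQuad (swapC.trans Φ) (-1 - 2 * ν) (1 + 2 * ν) (-1 + 2 * ν) (1 - 2 * ν) hx hy) δ with hL
  have hxm : (-1 - ν : ℝ) < 1 + ν := by linarith
  have hym : (-1 + ν : ℝ) < 1 - ν := by linarith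
  -- (1) off the crossing event, the dual configuration crosses `L_ν`
  have hincl : (quadCrossing R δ)ᶜ ⊆ dualConfig ⁻¹' L := by
    intro ω hω
    have hncr : ¬ ChartCrossed (swapC.trans Φ) (-1) 1 (-1) 1 δ ω :=
      fun h => hω ((mem_quadCrossing_iff_chartCrossed hΦ hδ ω).2 h)
    -- part B: the dual configuration chart-crosses the `ν`-perturbed transversal rectangle
    have hB := selfDual_chart_atLeastOne Φ δ ν hδ hν (by linarith) hmod ω hncr
    -- part C: a quad crossing for the moving chart `swap ∘ Φ'`
    have hC : dualConfig ω ∈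
        quadCrossing (perturbQuad (swapC.trans Φ') (-1 - ν) (1 + ν) (-1 + ν) (1 - ν) hxm hym) δ :=
      (chartCrossed_iff_mem_quadCrossing_perturbQuad Φ' (-1 + ν) (1 - ν) (-1 - ν) (1 + ν) hym hxm δ hδ
        (dualConfig ω)).1 hB
    -- part D: the fixed easier quad `L_ν` (chart `swap ∘ Φ`)
    exact quadCrossing_perturbQuad_mono_of_near (swapC.trans Φ') (swapC.trans Φ) ν
      (-1 - 2 * ν) (1 + 2 * ν) (-1 + 2 * ν) (1 - 2 * ν) (-1 - ν) (1 + ν) (-1 + ν) (1 - ν) hx hy hxm hym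
      (by linarith) (by linarith) (by linarith) (by linarith)
      (near_of_moving hδ hmod hxm hym (by linarith) (by linarith) (by linarith) (by linarith)) δ hC
  -- (2) probabilities
  have hmeas : MeasurableSet (quadCrossing R δ) := measurableSet_quadCrossing R hδ
  have h1 : (bondPercolation (zdGraph 2) half).real (quadCrossing R δ)ᶜ =
      1 - (bondPercolation (zdGraph 2) half).real (quadCrossing R δ) := probReal_compl_eq_one_sub hmeas
  have h2 : (bondPercolation (zdGraph 2) half).real (quadCrossing R δ)ᶜ ≤
      (bondPercolation (zdGraph 2) half).real (dualConfig ⁻¹' L) := measureReal_mono hincl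
  have h3 : (bondPercolation (zdGraph 2) half).real (dualConfig ⁻¹' L) = (bondPercolation (zdGraph 2) half).real L :=
    bondPercolation_half_real_preimage_dualConfig (measurableSet_quadCrossing _ hδ)
  show 1 ≤ (bondPercolation (zdGraph 2) half).real (quadCrossing R δ) + (bondPercolation (zdGraph 2) half).real L
  linarith

/-! ### The upper bound: an open crossing of `R` excludes a dual crossing of `U_ν` -/

/-- **`P[𝒞_δ(R)] + P[𝒞_δ(U_ν)] ≤ 1`** below the mesh threshold (`U_ν` the harder transversal quad).
[cite: BollobasRiordan2006, Ch. 7 Claim 19 p. 192] -/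
theorem add_le_one (hΦ : IsSquareModel R Φ) {ν δ : ℝ} (hν : 0 < ν) (hν2 : ν < 1 / 2) (hδ : 0 < δ)
    (hmod : ∀ p q : ℂ, q ∈ Φ '' closedBall (0 : ℂ) 5 → dist p q ≤ 4 * δ → dist (Φ.symm p) (Φ.symm q) ≤ ν)
    (hx : (-1 - 2 * ν : ℝ) < 1 + 2 * ν) (hy : (-1 + 2 * ν : ℝ) < 1 - 2 * ν) :
    quadCrossingProb δ R +
      quadCrossingProb δ (perturbQuad (swapC.trans Φ) (-1 + 2 * ν) (1 - 2 * ν) (-1 - 2 * ν) (1 + 2 * ν) hy hx) ≤ 1 := by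
  set Φ' : ℂ ≃ₜ ℂ := Φ.trans (Homeomorph.addRight (-dualShift δ)) with hΦ'
  set U : Set (BondConfig (Site 2)) :=
    quadCrossing (perturbQuad (swapC.trans Φ) (-1 + 2 * ν) (1 - 2 * ν) (-1 - 2 * ν) (1 + 2 * ν) hy hx) δ with hU
  have hxm : (-1 - ν : ℝ) < 1 + ν := by linarith
  have hym : (-1 + ν : ℝ) < 1 - ν := by linarith
  -- (1) the crossing event and the dual preimage of `U_ν` are disjoint
  have hdisj : Disjoint (quadCrossing R δ) (dualConfig ⁻¹' U) := by
    rw [Set.disjoint_left]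
    intro ω hω hωU
    have hcr : ChartCrossed (swapC.trans Φ) (-1) 1 (-1) 1 δ ω := (mem_quadCrossing_iff_chartCrossed hΦ hδ ω).1 hω
    -- part D: the dual configuration crosses the `ν`-harder transversal quad of the moving chart
    have hD : dualConfig ω ∈
        quadCrossing (perturbQuad (swapC.trans Φ') (-1 + ν) (1 - ν) (-1 - ν) (1 + ν) hym hxm) δ :=
      quadCrossing_perturbQuad_mono_of_near (swapC.trans Φ) (swapC.trans Φ') ν
        (-1 + ν) (1 - ν) (-1 - ν) (1 + ν) (-1 + 2 * ν) (1 - 2 * ν) (-1 - 2 * ν) (1 + 2 * ν) hym hxm hy hx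
        (by linarith) (by linarith) (by linarith) (by linarith)
        (near_of_fixed hδ hmod hy hx (by linarith) (by linarith) (by linarith) (by linarith)) δ hωU
    -- part C: i.e. a chart crossing of the wider-shorter rectangle for `Φ'`
    have hC : ChartCrossed Φ' (-1 - ν) (1 + ν) (-1 + ν) (1 - ν) δ (dualConfig ω) :=
      (chartCrossed_iff_mem_quadCrossing_perturbQuad Φ' (-1 - ν) (1 + ν) (-1 + ν) (1 - ν) hxm hym δ hδ
        (dualConfig ω)).2 hD
    -- part A: impossible
    exact selfDual_chart_notBoth Φ δ hδ (-1 - ν) (1 + ν) (-1 + ν) (1 - ν) (by linarith) (by linarith)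
      (by linarith) (by linarith) (by linarith) ω hcr hC
  -- (2) probabilities
  have hmeasU : MeasurableSet U := measurableSet_quadCrossing _ hδ
  have h1 : (bondPercolation (zdGraph 2) half).real (quadCrossing R δ ∪ dualConfig ⁻¹' U) =
      (bondPercolation (zdGraph 2) half).real (quadCrossing R δ) +
        (bondPercolation (zdGraph 2) half).real (dualConfig ⁻¹' U) :=
    measureReal_union hdisj (measurable_dualConfig hmeasU)
  have h2 : (bondPercolation (zdGraph 2) half).real (quadCrossing R δ ∪ dualConfig ⁻¹' U) ≤ 1 := measureReal_le_one
  have h3 : (bondPercolation (zdGraph 2) half).real (dualConfig ⁻¹' U) = (bondPercolation (zdGraph 2) half).real U :=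
    bondPercolation_half_real_preimage_dualConfig hmeasU
  show (bondPercolation (zdGraph 2) half).real (quadCrossing R δ) + (bondPercolation (zdGraph 2) half).real U ≤ 1
  linarith

end SelfDual

/-- **Registered sub-goal `selfDual_mesh_bounds` (line `registered`, lead c4; structure of joint limits,
part 8b) — the two one-sided duality bounds at small mesh.** For a square model `Φ` of the conformal
rectangle `R` and a margin `0 < ν < 1/2` there is a mesh threshold `δ₀ > 0` such that for all
`0 < δ ≤ δ₀`: `1 ≤ P[𝒞_δ(R)] + P[𝒞_δ(L_ν)]` and `P[𝒞_δ(R)] + P[𝒞_δ(U_ν)] ≤ 1`, where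
`L_ν = (swap ∘ Φ)([-1-2ν, 1+2ν] × [-1+2ν, 1-2ν])` and `U_ν = (swap ∘ Φ)([-1+2ν, 1-2ν] × [-1-2ν, 1+2ν])`
are the transversal quads (crossed between the images of the right and left sides of the square) that
are slightly easier, resp. slightly harder, than the re-marked rectangle `R⁺`.
[cite: SchrammSmirnov2011, §1.3 and proof of Lemma 6.1] -/
theorem selfDual_mesh_bounds : ∀ (R : Literature.Probability.RandomPlanarGeometry.ConformalRectangle) (Φ : ℂ ≃ₜ ℂ), Literature.Probability.Percolation.IsSquareModel R Φ → ∀ ν : ℝ, 0 < ν → ν < 1 / 2 → ∀ (hx : (-1 - 2 * ν : ℝ) < 1 + 2 * ν) (hy : (-1 + 2 * ν : ℝ) < 1 - 2 * ν), ∃ δ₀ : ℝ, 0 < δ₀ ∧ ∀ δ : ℝ, 0 < δ → δ ≤ δ₀ → 1 ≤ Literature.Probability.Percolation.quadCrossingProb δ R + Literature.Probability.Percolation.quadCrossingProb δ (Literature.Probability.Percolation.perturbQuad (Literature.Probability.Percolation.SSContinuity.swapC.trans Φ) (-1 - 2 * ν) (1 + 2 * ν) (-1 + 2 * ν) (1 -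 2 * ν) hx hy) ∧ Literature.Probability.Percolation.quadCrossingProb δ R + Literature.Probability.Percolation.quadCrossingProb δ (Literature.Probability.Percolation.perturbQuad (Literature.Probability.Percolation.SSContinuity.swapC.trans Φ) (-1 + 2 * ν) (1 - 2 * ν) (-1 - 2 * ν) (1 + 2 * ν) hy hx) ≤ 1 := by
  intro R Φ hΦ ν hν hν2 hx hy
  obtain ⟨δ₀, hδ₀, hmod⟩ := SelfDual.exists_mesh_threshold Φ hν
  exact ⟨δ₀, hδ₀, fun δ hδ hδle =>
    ⟨SelfDual.one_le_add hΦ hν hν2 hδ (hmod δ hδ hδle) hx hy, SelfDual.add_le_one hΦ hν hν2 hδ (hmod δ hδ hδle) hx hy⟩⟩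

end Summit.CriticalPhenomena.CardyFormulaZ2.Cruxes.SubseqCardy.Birth

end
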